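import Literature.Computability.AlgebraicComplexity.DIP20PlethysmSemigroupGenerators47Data1
import Literature.Computability.AlgebraicComplexity.DIP20PlethysmSemigroupGenerators47Data2
import Literature.Computability.AlgebraicComplexity.DIP20PlethysmSemigroupGenerators47Data3
import Literature.Computability.AlgebraicComplexity.DIP20PlethysmSemigroupGenerators47Data4
import Literature.Computability.AlgebraicComplexity.DIP20PlethysmSemigroupGenerators47Data5
import Literature.Computability.AlgebraicComplexity.DIP20PlethysmSemigroupGenerators47Data6
import HarnessLib

/-!
# Dörfler–Ikenmeyer–Panova 2019, Prop. 3.14 discharged: the positive-plethysm semigroup for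
# `(m, n) = (4, 7)` is generated by `X` from degree `14` on

Topic `Literature/Computability/AlgebraicComplexity`; assembles the certificate of
`DIP20PlethysmSemigroupGenerators47Cert.lean` / `…Data1 … Data6.lean` and proves its meaning.

**`DIP20_prop_3_14_holds`** discharges the named fact `DIP20_prop_3_14` of
`DIP20MultiplicityObstructions.lean` — J. Dörfler, C. Ikenmeyer, G. Panova, *On geometric complexity
theory: multiplicity obstructions are stronger than occurrence obstructions*, SIAM J. Appl. Algebra
Geom. 4 (2020) = arXiv:1901.04576, Prop. 3.14 (arXiv p. 7; TeX `multobs.tex` L498 `{pro:generators74}`;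
held text `paper-arxiv-1901.04576` p0008.txt:L3 "Proposition 12"): "If `λ` is a 4-partition of `7d`,
`d ≥ 14`, and `λ̄ ∉ Y`, then `λ` is a sum of partitions from `X`" ("proved completely analogously to
Proposition 3.10").

Proof, along the printed proof of Prop. 3.10 transposed to `n = 7` and four rows: strong induction on
`d`, removing one of the twelve rows `genMoves47` of `X` —
`(7)`, `(8,6)`, `(8,8,5)`, `(9,6,6)`, `(10,10,1)`, `(8,8,8,4)`, `(10,10,4,4)`, `(9,8,6,5)`, `(10,6,6,6)`, `(14,14)`, `(14,14,14)`, `(14,14,14,14)` —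
whenever its linear applicability conditions hold (`c₁ = λ₁-λ₂ ≥ g₁-g₂`, `c₂ ≥ g₂-g₃`, `c₃ ≥ g₃-g₄`,
`λ₄ ≥ g₄` so that `λ - g` is a partition; `λ₂ - g₂ ≥ 7` so that the new tail is not in `Y` — all bodies
of `Y` have first part `≤ 6`, `not_mem_dipTails47_of_seven_le`; and `d - |g|/7 ≥ 14`). (The literal
analogues `(7,7)`, `(7,7,7)`, `(7,7,7,7)` of Prop. 3.10's moves are not in `X`.) If no move applies,
the pigeonhole count gives `d ≤ 21` (from the moves `(7)`, `(14,14)`, `(14,14,14)`, `(14,14,14,14)`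
alone: `c₁ ≤ 6` and either `λ₂ ≤ 20`, whence `|λ| ≤ 86`, or `c₂, c₃, λ₄ ≤ 13`, whence `|λ| ≤ 123`;
both `< 7 · 22`), and `λ` is *residual*: enumerated by `resid47 d` (complete: `mem_resid47`) and covered,
segment by segment, by the `10294` kernel-checked certificates of the data files.

Side results of the search (not used): the conclusion also holds for `11 ≤ d ≤ 13` (all non-`Y`
4-partitions of `77`, `84`, `91` decompose) and fails for `d = 10` exactly at `(35,35)`.

## References

* J. Dörfler, C. Ikenmeyer, G. Panova, SIAM J. Appl. Algebra Geom. 4 (2020) = arXiv:1901.04576,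
  Prop. 3.14, Lemma 3.13 (`Y`), Prop. 7.1 (`X`), proof of Prop. 3.10 (arXiv p. 7).
  [key `DorflerIkenmeyerPanova2020`]
-/

namespace Literature.Computability.AlgebraicComplexity

section Discharge

/-- **The computer calculation, `d = 14`**: every residual partition of `98` is a sum of rows of `X`
(the four segments glued by `take_append_drop`). [cite: DorflerIkenmeyerPanova2020, Prop. 3.14 (proof: "proved completely analogously to Proposition 3.10" — computer calculation in small degrees, arXiv p. 7)] -/
theorem quadRow_mem_closure_of_mem_resid47_14 {t : ℕ × ℕ × ℕ × ℕ} (h : t ∈ resid47 14) :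
    quadRow t ∈ AddSubmonoid.closure dipGenerators47 := by
  rw [← List.take_append_drop 1892 (resid47 14), List.mem_append] at h
  rcases h with h | h
  · exact quadRow_mem_closure_of_mem_seg47_14_1 h
  rw [← List.take_append_drop 1892 ((resid47 14).drop 1892), List.mem_append] at h
  rcases h with h | h
  · exact quadRow_mem_closure_of_mem_seg47_14_2 h
  rw [← List.take_append_drop 1892 (((resid47 14).drop 1892).drop 1892), List.mem_append] at h
  rcases h with h | h
  · exact quadRow_mem_closure_of_mem_seg47_14_3 h
  · exact quadRow_mem_closure_of_mem_seg47_14_4 h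

/-- **Discharge of Prop. 3.14** ("If `λ` is a 4-partition of `7d`, `d ≥ 14`, and `λ̄ ∉ Y`, then `λ` is a
sum of partitions from `X`", arXiv p. 7). [cite: DorflerIkenmeyerPanova2020, Prop. 3.14 (arXiv p. 7; TeX multobs.tex L498 {pro:generators74}; held paper-arxiv-1901.04576 p0008.txt:L3 "Proposition 12")] -/
theorem DIP20_prop_3_14_holds : DIP20_prop_3_14 := by
  intro d hd
  induction d using Nat.strong_induction_on with
  | _ d ih =>
  intro μ hμ hsum hex
  have h10 : μ 1 ≤ μ 0 := hμ (show (0 : Fin 4) ≤ 1 by decide)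
  have h21 : μ 2 ≤ μ 1 := hμ (show (1 : Fin 4) ≤ 2 by decide)
  have h32 : μ 3 ≤ μ 2 := hμ (show (2 : Fin 4) ≤ 3 by decide)
  rw [Fin.sum_univ_four] at hsum
  rw [← quadRow_apply_eq μ]
  by_cases hM1 : 15 ≤ d ∧ 7 ≤ μ 0 - μ 1
  · -- remove `(7)`
    have h' := ih (d - 1) (by omega) (by omega) (quadRow (μ 0 - 7, μ 1, μ 2, μ 3))
      (antitone_quadRow (by omega) (by omega) (by omega))
      (by simp only [Fin.sum_univ_four, quadRow]; simp; omega)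
      (by simpa [quadRow] using hex)
    have hrow : quadRow (μ 0, μ 1, μ 2, μ 3) = quadRow (μ 0 - 7, μ 1, μ 2, μ 3) + quadRow (7, 0, 0, 0) := by
      rw [← quadRow_addQuad]; congr 1; simp only [addQuad, Prod.mk.injEq]; omega
    rw [hrow]
    exact add_mem h' (AddSubmonoid.subset_closure (quadRow_mem_dipGenerators47
      (genMoves47_subset _ (by decide))))
  by_cases hM2 : 16 ≤ d ∧ 2 ≤ μ 0 - μ 1 ∧ 6 ≤ μ 1 - μ 2 ∧ 13 ≤ μ 1
  · -- remove `(8,6)`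
    have h' := ih (d - 2) (by omega) (by omega) (quadRow (μ 0 - 8, μ 1 - 6, μ 2, μ 3))
      (antitone_quadRow (by omega) (by omega) (by omega))
      (by simp only [Fin.sum_univ_four, quadRow]; simp; omega)
      (by simpa [quadRow] using not_mem_dipTails47_of_seven_le (b := μ 1 - 6) (c := μ 2) (e := μ 3) (by omega))
    have hrow : quadRow (μ 0, μ 1, μ 2, μ 3) = quadRow (μ 0 - 8, μ 1 - 6, μ 2, μ 3) + quadRow (8, 6, 0, 0) := by
      rw [← quadRow_addQuad]; congr 1; simp only [addQuad, Prod.mk.injEq]; omega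
    rw [hrow]
    exact add_mem h' (AddSubmonoid.subset_closure (quadRow_mem_dipGenerators47
      (genMoves47_subset _ (by decide))))
  by_cases hM3 : 17 ≤ d ∧ 3 ≤ μ 1 - μ 2 ∧ 5 ≤ μ 2 - μ 3 ∧ 15 ≤ μ 1
  · -- remove `(8,8,5)`
    have h' := ih (d - 3) (by omega) (by omega) (quadRow (μ 0 - 8, μ 1 - 8, μ 2 - 5, μ 3))
      (antitone_quadRow (by omega) (by omega) (by omega))
      (by simp only [Fin.sum_univ_four, quadRow]; simp; omega)
      (by simpa [quadRow] using not_mem_dipTails47_of_seven_le (b := μ 1 - 8) (c := μ 2 - 5) (e := μ 3) (by omega))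
    have hrow : quadRow (μ 0, μ 1, μ 2, μ 3) = quadRow (μ 0 - 8, μ 1 - 8, μ 2 - 5, μ 3) + quadRow (8, 8, 5, 0) := by
      rw [← quadRow_addQuad]; congr 1; simp only [addQuad, Prod.mk.injEq]; omega
    rw [hrow]
    exact add_mem h' (AddSubmonoid.subset_closure (quadRow_mem_dipGenerators47
      (genMoves47_subset _ (by decide))))
  by_cases hM4 : 17 ≤ d ∧ 3 ≤ μ 0 - μ 1 ∧ 6 ≤ μ 2 - μ 3 ∧ 13 ≤ μ 1
  · -- remove `(9,6,6)`
    have h' := ih (d - 3) (by omega) (by omega) (quadRow (μ 0 - 9, μ 1 - 6, μ 2 - 6, μ 3))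
      (antitone_quadRow (by omega) (by omega) (by omega))
      (by simp only [Fin.sum_univ_four, quadRow]; simp; omega)
      (by simpa [quadRow] using not_mem_dipTails47_of_seven_le (b := μ 1 - 6) (c := μ 2 - 6) (e := μ 3) (by omega))
    have hrow : quadRow (μ 0, μ 1, μ 2, μ 3) = quadRow (μ 0 - 9, μ 1 - 6, μ 2 - 6, μ 3) + quadRow (9, 6, 6, 0) := by
      rw [← quadRow_addQuad]; congr 1; simp only [addQuad, Prod.mk.injEq]; omega
    rw [hrow]
    exact add_mem h' (AddSubmonoid.subset_closure (quadRow_mem_dipGenerators47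
      (genMoves47_subset _ (by decide))))
  by_cases hM5 : 17 ≤ d ∧ 9 ≤ μ 1 - μ 2 ∧ 1 ≤ μ 2 - μ 3 ∧ 17 ≤ μ 1
  · -- remove `(10,10,1)`
    have h' := ih (d - 3) (by omega) (by omega) (quadRow (μ 0 - 10, μ 1 - 10, μ 2 - 1, μ 3))
      (antitone_quadRow (by omega) (by omega) (by omega))
      (by simp only [Fin.sum_univ_four, quadRow]; simp; omega)
      (by simpa [quadRow] using not_mem_dipTails47_of_seven_le (b := μ 1 - 10) (c := μ 2 - 1) (e := μ 3) (by omega))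
    have hrow : quadRow (μ 0, μ 1, μ 2, μ 3) = quadRow (μ 0 - 10, μ 1 - 10, μ 2 - 1, μ 3) + quadRow (10, 10, 1, 0) := by
      rw [← quadRow_addQuad]; congr 1; simp only [addQuad, Prod.mk.injEq]; omega
    rw [hrow]
    exact add_mem h' (AddSubmonoid.subset_closure (quadRow_mem_dipGenerators47
      (genMoves47_subset _ (by decide))))
  by_cases hM6 : 18 ≤ d ∧ 4 ≤ μ 2 - μ 3 ∧ 4 ≤ μ 3 ∧ 15 ≤ μ 1
  · -- remove `(8,8,8,4)`
    have h' := ih (d - 4) (by omega) (by omega) (quadRow (μ 0 - 8, μ 1 - 8, μ 2 - 8, μ 3 - 4))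
      (antitone_quadRow (by omega) (by omega) (by omega))
      (by simp only [Fin.sum_univ_four, quadRow]; simp; omega)
      (by simpa [quadRow] using not_mem_dipTails47_of_seven_le (b := μ 1 - 8) (c := μ 2 - 8) (e := μ 3 - 4) (by omega))
    have hrow : quadRow (μ 0, μ 1, μ 2, μ 3) = quadRow (μ 0 - 8, μ 1 - 8, μ 2 - 8, μ 3 - 4) + quadRow (8, 8, 8, 4) := by
      rw [← quadRow_addQuad]; congr 1; simp only [addQuad, Prod.mk.injEq]; omega
    rw [hrow]
    exact add_mem h' (AddSubmonoid.subset_closure (quadRow_mem_dipGenerators47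
      (genMoves47_subset _ (by decide))))
  by_cases hM7 : 18 ≤ d ∧ 6 ≤ μ 1 - μ 2 ∧ 4 ≤ μ 3 ∧ 17 ≤ μ 1
  · -- remove `(10,10,4,4)`
    have h' := ih (d - 4) (by omega) (by omega) (quadRow (μ 0 - 10, μ 1 - 10, μ 2 - 4, μ 3 - 4))
      (antitone_quadRow (by omega) (by omega) (by omega))
      (by simp only [Fin.sum_univ_four, quadRow]; simp; omega)
      (by simpa [quadRow] using not_mem_dipTails47_of_seven_le (b := μ 1 - 10) (c := μ 2 - 4) (e := μ 3 - 4) (by omega))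
    have hrow : quadRow (μ 0, μ 1, μ 2, μ 3) = quadRow (μ 0 - 10, μ 1 - 10, μ 2 - 4, μ 3 - 4) + quadRow (10, 10, 4, 4) := by
      rw [← quadRow_addQuad]; congr 1; simp only [addQuad, Prod.mk.injEq]; omega
    rw [hrow]
    exact add_mem h' (AddSubmonoid.subset_closure (quadRow_mem_dipGenerators47
      (genMoves47_subset _ (by decide))))
  by_cases hM8 : 18 ≤ d ∧ 1 ≤ μ 0 - μ 1 ∧ 2 ≤ μ 1 - μ 2 ∧ 1 ≤ μ 2 - μ 3 ∧ 5 ≤ μ 3 ∧ 15 ≤ μ 1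
  · -- remove `(9,8,6,5)`
    have h' := ih (d - 4) (by omega) (by omega) (quadRow (μ 0 - 9, μ 1 - 8, μ 2 - 6, μ 3 - 5))
      (antitone_quadRow (by omega) (by omega) (by omega))
      (by simp only [Fin.sum_univ_four, quadRow]; simp; omega)
      (by simpa [quadRow] using not_mem_dipTails47_of_seven_le (b := μ 1 - 8) (c := μ 2 - 6) (e := μ 3 - 5) (by omega))
    have hrow : quadRow (μ 0, μ 1, μ 2, μ 3) = quadRow (μ 0 - 9, μ 1 - 8, μ 2 - 6, μ 3 - 5) + quadRow (9, 8, 6, 5) := by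
      rw [← quadRow_addQuad]; congr 1; simp only [addQuad, Prod.mk.injEq]; omega
    rw [hrow]
    exact add_mem h' (AddSubmonoid.subset_closure (quadRow_mem_dipGenerators47
      (genMoves47_subset _ (by decide))))
  by_cases hM9 : 18 ≤ d ∧ 4 ≤ μ 0 - μ 1 ∧ 6 ≤ μ 3 ∧ 13 ≤ μ 1
  · -- remove `(10,6,6,6)`
    have h' := ih (d - 4) (by omega) (by omega) (quadRow (μ 0 - 10, μ 1 - 6, μ 2 - 6, μ 3 - 6))
      (antitone_quadRow (by omega) (by omega) (by omega))
      (by simp only [Fin.sum_univ_four, quadRow]; simp; omega)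
      (by simpa [quadRow] using not_mem_dipTails47_of_seven_le (b := μ 1 - 6) (c := μ 2 - 6) (e := μ 3 - 6) (by omega))
    have hrow : quadRow (μ 0, μ 1, μ 2, μ 3) = quadRow (μ 0 - 10, μ 1 - 6, μ 2 - 6, μ 3 - 6) + quadRow (10, 6, 6, 6) := by
      rw [← quadRow_addQuad]; congr 1; simp only [addQuad, Prod.mk.injEq]; omega
    rw [hrow]
    exact add_mem h' (AddSubmonoid.subset_closure (quadRow_mem_dipGenerators47
      (genMoves47_subset _ (by decide))))
  by_cases hM10 : 18 ≤ d ∧ 14 ≤ μ 1 - μ 2 ∧ 21 ≤ μ 1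
  · -- remove `(14,14)`
    have h' := ih (d - 4) (by omega) (by omega) (quadRow (μ 0 - 14, μ 1 - 14, μ 2, μ 3))
      (antitone_quadRow (by omega) (by omega) (by omega))
      (by simp only [Fin.sum_univ_four, quadRow]; simp; omega)
      (by simpa [quadRow] using not_mem_dipTails47_of_seven_le (b := μ 1 - 14) (c := μ 2) (e := μ 3) (by omega))
    have hrow : quadRow (μ 0, μ 1, μ 2, μ 3) = quadRow (μ 0 - 14, μ 1 - 14, μ 2, μ 3) + quadRow (14, 14, 0, 0) := by
      rw [← quadRow_addQuad]; congr 1; simp only [addQuad, Prod.mk.injEq]; omega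
    rw [hrow]
    exact add_mem h' (AddSubmonoid.subset_closure (quadRow_mem_dipGenerators47
      (genMoves47_subset _ (by decide))))
  by_cases hM11 : 20 ≤ d ∧ 14 ≤ μ 2 - μ 3 ∧ 21 ≤ μ 1
  · -- remove `(14,14,14)`
    have h' := ih (d - 6) (by omega) (by omega) (quadRow (μ 0 - 14, μ 1 - 14, μ 2 - 14, μ 3))
      (antitone_quadRow (by omega) (by omega) (by omega))
      (by simp only [Fin.sum_univ_four, quadRow]; simp; omega)
      (by simpa [quadRow] using not_mem_dipTails47_of_seven_le (b := μ 1 - 14) (c := μ 2 - 14) (e := μ 3) (by omega))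
    have hrow : quadRow (μ 0, μ 1, μ 2, μ 3) = quadRow (μ 0 - 14, μ 1 - 14, μ 2 - 14, μ 3) + quadRow (14, 14, 14, 0) := by
      rw [← quadRow_addQuad]; congr 1; simp only [addQuad, Prod.mk.injEq]; omega
    rw [hrow]
    exact add_mem h' (AddSubmonoid.subset_closure (quadRow_mem_dipGenerators47
      (genMoves47_subset _ (by decide))))
  by_cases hM12 : 22 ≤ d ∧ 14 ≤ μ 3 ∧ 21 ≤ μ 1
  · -- remove `(14,14,14,14)`
    have h' := ih (d - 8) (by omega) (by omega) (quadRow (μ 0 - 14, μ 1 - 14, μ 2 - 14, μ 3 - 14))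
      (antitone_quadRow (by omega) (by omega) (by omega))
      (by simp only [Fin.sum_univ_four, quadRow]; simp; omega)
      (by simpa [quadRow] using not_mem_dipTails47_of_seven_le (b := μ 1 - 14) (c := μ 2 - 14) (e := μ 3 - 14) (by omega))
    have hrow : quadRow (μ 0, μ 1, μ 2, μ 3) = quadRow (μ 0 - 14, μ 1 - 14, μ 2 - 14, μ 3 - 14) + quadRow (14, 14, 14, 14) := by
      rw [← quadRow_addQuad]; congr 1; simp only [addQuad, Prod.mk.injEq]; omega
    rw [hrow]
    exact add_mem h' (AddSubmonoid.subset_closure (quadRow_mem_dipGenerators47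
      (genMoves47_subset _ (by decide))))
  -- no move applies: `d ≤ 21` by the pigeonhole count, and `λ` is residual
  have hd21 : d ≤ 21 := by
    clear hM2 hM3 hM4 hM5 hM6 hM7 hM8 hM9
    omega
  interval_cases d
  · exact quadRow_mem_closure_of_mem_resid47_14 (mem_resid47 h32 h21 h10 (by omega) hex hM1 hM2 hM3 hM4 hM5 hM6 hM7 hM8 hM9 hM10 hM11 hM12)
  · exact quadRow_mem_closure_of_mem_seg47_15 (mem_resid47 h32 h21 h10 (by omega) hex hM1 hM2 hM3 hM4 hM5 hM6 hM7 hM8 hM9 hM10 hM11 hM12)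
  · exact quadRow_mem_closure_of_mem_seg47_16 (mem_resid47 h32 h21 h10 (by omega) hex hM1 hM2 hM3 hM4 hM5 hM6 hM7 hM8 hM9 hM10 hM11 hM12)
  · exact quadRow_mem_closure_of_mem_seg47_17 (mem_resid47 h32 h21 h10 (by omega) hex hM1 hM2 hM3 hM4 hM5 hM6 hM7 hM8 hM9 hM10 hM11 hM12)
  · exact quadRow_mem_closure_of_mem_seg47_18 (mem_resid47 h32 h21 h10 (by omega) hex hM1 hM2 hM3 hM4 hM5 hM6 hM7 hM8 hM9 hM10 hM11 hM12)
  · exact quadRow_mem_closure_of_mem_seg47_19 (mem_resid47 h32 h21 h10 (by omega) hex hM1 hM2 hM3 hM4 hM5 hM6 hM7 hM8 hM9 hM10 hM11 hM12)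
  · exact quadRow_mem_closure_of_mem_seg47_20 (mem_resid47 h32 h21 h10 (by omega) hex hM1 hM2 hM3 hM4 hM5 hM6 hM7 hM8 hM9 hM10 hM11 hM12)
  · exact quadRow_mem_closure_of_mem_seg47_21 (mem_resid47 h32 h21 h10 (by omega) hex hM1 hM2 hM3 hM4 hM5 hM6 hM7 hM8 hM9 hM10 hM11 hM12)

end Discharge

end Literature.Computability.AlgebraicComplexity
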